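import Literature.MathematicalPhysics.StatisticalMechanics.LennardJonesClusters
import Mathlib.MeasureTheory.Measure.Lebesgue.EqHaar
import HarnessLib

/-!
# Shell counts and cross sums over separated configurations

Two elementary packing estimates for finite configurations of points with mutual distances
`≥ δ₀ > 0` ("separated"), companions of `card_le_of_separated_of_dist_le`
(`LennardJonesClusters.lean`, points in a ball) used by cavity / far-paste surgeries on
Lennard-Jones ground states (route `SquareWellLayerCake`, crux `StackingFaultSparsity`,
stmt-AtomisticToContinuum-14296, stub `stub_farPaste`), and generic:

* `card_le_of_separated_of_mem_shell` — `r`-separated points of the spherical shell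
  `R₁ ≤ dist · p ≤ R₂` number at most `(2R₂/r + 1)ⁿ − (max (2R₁/r − 1) 0)ⁿ` (the balls of radius
  `r/2` about them are disjoint, lie in `ball p (R₂ + r/2)` and avoid `closedBall p (R₁ − r/2)`);
* `card_shell_le` — in `ℝ³`, for `δ₀ ≤ 1 ≤ ρ`, a shell `ρ - k - 1 < dist · c ≤ ρ - k` of unit
  thickness holds at most `108 δ₀⁻³ ρ²` points of a `δ₀`-separated configuration;
* `sum_cross_inv_pow_six_le_of_tail` — CROSS SUMS: if far tails are controlled,
  `∑_{j ≠ i, |yᵢ−yⱼ| ≥ ℓ} |yᵢ−yⱼ|⁻⁶ ≤ C_t ℓ⁻³` for all `ℓ ≥ δ₀` (as supplied by the dyadic-shell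
  bound of the routes, `PricedHcpWindowsFarTail.stub_farTail`), then for every centre `c` and radius
  `ρ ≥ 1` the interaction across the sphere of radius `ρ`,
  `∑_{|yᵢ−c| ≤ ρ} ∑_{|yⱼ−c| > ρ} |yᵢ−yⱼ|⁻⁶`, is at most `C ρ²` with
  `C = 108 δ₀⁻³ C_t (δ₀⁻³ + 2)` — an AREA law: a particle at depth `t` below the sphere sees the
  outside only beyond distance `t`, contributing `≤ C_t max(t, δ₀)⁻³`; the unit shells at depth
  `k` hold `≤ 108 δ₀⁻³ ρ²` particles each, and `∑_k max(k, δ₀)⁻³ ≤ δ₀⁻³ + 2`.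

All `[folklore]` (volume packing; e.g. the argument of Mathlib's `Besicovitch.card_le_of_separated`).
-/

noncomputable section

open scoped BigOperators ENNReal
open Metric Set Module MeasureTheory

namespace Literature.MathematicalPhysics.StatisticalMechanics

/-! ## Points in a spherical shell -/

open scoped Function in
/-- **Packing bound in a shell.** In an `n`-dimensional real normed space (`n ≥ 1`), finitely many
points of the shell `R₁ ≤ dist · p ≤ R₂` (`R₁ ≤ R₂`, `0 ≤ R₂`) with mutual distances `≥ r > 0`
number at most `(2R₂/r + 1)ⁿ − (max (2R₁/r − 1) 0)ⁿ`: the balls of radius `r/2` about them are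
disjoint, lie in `ball p (R₂ + r/2)` and avoid `closedBall p (R₁ − r/2)`. [folklore] -/
theorem card_le_of_separated_of_mem_shell {E : Type*} [NormedAddCommGroup E] [NormedSpace ℝ E]
    [FiniteDimensional ℝ E] [Nontrivial E] (s : Finset E) (p : E) {r R₁ R₂ : ℝ} (hr : 0 < r)
    (hR₂ : 0 ≤ R₂) (hR : R₁ ≤ R₂) (hs : ∀ c ∈ s, R₁ ≤ dist c p ∧ dist c p ≤ R₂)
    (h : ∀ c ∈ s, ∀ d ∈ s, c ≠ d → r ≤ dist c d) :
    (s.card : ℝ) ≤ (2 * R₂ / r + 1) ^ finrank ℝ E - (max (2 * R₁ / r - 1) 0) ^ finrank ℝ E := by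
  borelize E
  let μ : Measure E := Measure.addHaar
  have hnpos : 0 < finrank ℝ E := Module.finrank_pos
  have hn0 : finrank ℝ E ≠ 0 := hnpos.ne'
  set δ : ℝ := r / 2 with hδ
  set ρ₂ : ℝ := R₂ + r / 2 with hρ₂
  set ρ₁ : ℝ := max (R₁ - r / 2) 0 with hρ₁
  have δpos : 0 < δ := by positivity
  have ρ₂pos : 0 < ρ₂ := by positivity
  have ρ₁nn : 0 ≤ ρ₁ := le_max_right _ _
  set A := ⋃ c ∈ s, ball (c : E) δ with hA
  have D : Set.Pairwise (s : Set E) (Disjoint on fun c => ball (c : E) δ) := by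
    rintro c hc d hd hcd
    apply ball_disjoint_ball
    have := h c hc d hd hcd
    linarith
  have A_subset : A ⊆ ball p ρ₂ := by
    refine iUnion₂_subset fun x hx => ?_
    apply ball_subset_ball'
    have := (hs x hx).2
    linarith
  have hB₁pos : μ (ball (0 : E) 1) ≠ 0 := (measure_ball_pos _ _ zero_lt_one).ne'
  have hB₁top : μ (ball (0 : E) 1) ≠ ⊤ := measure_ball_lt_top.ne
  have hμA : μ A = (s.card : ℝ≥0∞) * ENNReal.ofReal (δ ^ finrank ℝ E) * μ (ball 0 1) := by
    rw [hA, measure_biUnion_finset D fun c _ => measurableSet_ball]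
    simp only [μ.addHaar_ball_of_pos _ δpos]
    simp only [Finset.sum_const, nsmul_eq_mul, mul_assoc]
  have hμB : μ (ball p ρ₂) = ENNReal.ofReal (ρ₂ ^ finrank ℝ E) * μ (ball 0 1) := by
    simp only [μ.addHaar_ball_of_pos _ ρ₂pos]
  -- the key measure inequality `card δⁿ + ρ₁ⁿ ≤ ρ₂ⁿ`
  have K : (s.card : ℝ) * δ ^ finrank ℝ E + ρ₁ ^ finrank ℝ E ≤ ρ₂ ^ finrank ℝ E := by
    rcases le_or_gt (R₁ - r / 2) 0 with h0 | h0
    · -- `ρ₁ = 0`: the ball argument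
      have hρ₁0 : ρ₁ = 0 := by rw [hρ₁]; exact max_eq_right h0
      rw [hρ₁0, zero_pow hn0, add_zero]
      have I : (s.card : ℝ≥0∞) * ENNReal.ofReal (δ ^ finrank ℝ E) * μ (ball 0 1) ≤
          ENNReal.ofReal (ρ₂ ^ finrank ℝ E) * μ (ball 0 1) := by
        rw [← hμA, ← hμB]; exact measure_mono A_subset
      have J : (s.card : ℝ≥0∞) * ENNReal.ofReal (δ ^ finrank ℝ E) ≤
          ENNReal.ofReal (ρ₂ ^ finrank ℝ E) :=
        (ENNReal.mul_le_mul_iff_left hB₁pos hB₁top).1 I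
      have := ENNReal.toReal_le_of_le_ofReal (pow_nonneg ρ₂pos.le _) J
      simpa [ENNReal.toReal_mul, ENNReal.toReal_ofReal (pow_nonneg δpos.le _)] using this
    · -- `ρ₁ = R₁ - r/2 > 0`: the small balls avoid `closedBall p ρ₁`
      have hρ₁eq : ρ₁ = R₁ - r / 2 := by rw [hρ₁]; exact max_eq_left h0.le
      have A_disj : Disjoint A (closedBall p ρ₁) := by
        rw [hA, Set.disjoint_iUnion₂_left]
        intro x hx
        rw [Set.disjoint_left]
        intro y hy hy'
        rw [mem_ball] at hy
        rw [mem_closedBall, hρ₁eq] at hy'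
        obtain ⟨hx1, -⟩ := hs x hx
        have htri : dist x p ≤ dist x y + dist y p := dist_triangle _ _ _
        rw [dist_comm x y] at htri
        linarith
      have hsub : A ∪ closedBall p ρ₁ ⊆ ball p ρ₂ := by
        refine Set.union_subset A_subset ?_
        apply closedBall_subset_ball
        rw [hρ₁eq, hρ₂]; linarith
      have hμC : μ (closedBall p ρ₁) = ENNReal.ofReal (ρ₁ ^ finrank ℝ E) * μ (ball 0 1) :=
        μ.addHaar_closedBall p ρ₁nn
      have I : (s.card : ℝ≥0∞) * ENNReal.ofReal (δ ^ finrank ℝ E) * μ (ball 0 1) +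
          ENNReal.ofReal (ρ₁ ^ finrank ℝ E) * μ (ball 0 1) ≤
            ENNReal.ofReal (ρ₂ ^ finrank ℝ E) * μ (ball 0 1) := by
        rw [← hμA, ← hμB, ← hμC, ← measure_union A_disj measurableSet_closedBall]
        exact measure_mono hsub
      rw [← add_mul] at I
      have J : (s.card : ℝ≥0∞) * ENNReal.ofReal (δ ^ finrank ℝ E) +
          ENNReal.ofReal (ρ₁ ^ finrank ℝ E) ≤ ENNReal.ofReal (ρ₂ ^ finrank ℝ E) :=
        (ENNReal.mul_le_mul_iff_left hB₁pos hB₁top).1 I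
      have := ENNReal.toReal_le_of_le_ofReal (pow_nonneg ρ₂pos.le _) J
      rw [ENNReal.toReal_add (by simp [ENNReal.mul_eq_top]) ENNReal.ofReal_ne_top] at this
      simpa [ENNReal.toReal_mul, ENNReal.toReal_ofReal (pow_nonneg δpos.le _),
        ENNReal.toReal_ofReal (pow_nonneg ρ₁nn _)] using this
  -- algebra: divide by `δⁿ`
  have hδn : 0 < δ ^ finrank ℝ E := pow_pos δpos _
  have hq₂ : ρ₂ / δ = 2 * R₂ / r + 1 := by rw [hρ₂, hδ]; field_simp
  have hq₁ : ρ₁ / δ = max (2 * R₁ / r - 1) 0 := by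
    rw [hρ₁, ← max_div_div_right δpos.le, zero_div]
    congr 1
    rw [hδ]; field_simp
  calc (s.card : ℝ) ≤ (ρ₂ ^ finrank ℝ E - ρ₁ ^ finrank ℝ E) / δ ^ finrank ℝ E := by
        rw [le_div_iff₀ hδn]; linarith
    _ = (ρ₂ / δ) ^ finrank ℝ E - (ρ₁ / δ) ^ finrank ℝ E := by rw [sub_div, ← div_pow, ← div_pow]
    _ = (2 * R₂ / r + 1) ^ finrank ℝ E - (max (2 * R₁ / r - 1) 0) ^ finrank ℝ E := by
        rw [hq₂, hq₁]

/-! ## Unit shells in `ℝ³` -/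

/-- Difference of cubes at bounded gap: `x³ − (max (x − g) 0)³ ≤ 3 x² g` for `0 ≤ g`, `0 ≤ x`.
[folklore] -/
theorem cube_sub_cube_le {x g : ℝ} (hx : 0 ≤ x) (hg : 0 ≤ g) :
    x ^ 3 - (max (x - g) 0) ^ 3 ≤ 3 * x ^ 2 * g := by
  rcases le_or_gt (x - g) 0 with h | h
  · rw [max_eq_right h]; nlinarith [sq_nonneg x]
  · rw [max_eq_left h.le]; nlinarith [sq_nonneg g, mul_nonneg hx hg]

/-- **Points of a separated configuration in a unit shell of `ℝ³`.** For a `δ₀`-separated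
configuration `y` (`0 < δ₀ ≤ 1`), a centre `c`, a radius `ρ ≥ 1` and `k : ℕ`, the particles with
`ρ − k − 1 < dist (y i) c ≤ ρ − k` number at most `108 δ₀⁻³ ρ²`. [folklore] -/
theorem card_shell_le {δ₀ : ℝ} (hδ₀ : 0 < δ₀) (hδ₁ : δ₀ ≤ 1) {N : ℕ}
    (y : Fin N → EuclideanSpace ℝ (Fin 3)) (hsep : ∀ i j : Fin N, i ≠ j → δ₀ ≤ dist (y i) (y j))
    (c : EuclideanSpace ℝ (Fin 3)) {ρ : ℝ} (hρ : 1 ≤ ρ) (k : ℕ) :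
    (((Finset.univ.filter fun i : Fin N =>
        ρ - k - 1 < dist (y i) c ∧ dist (y i) c ≤ ρ - k)).card : ℝ) ≤ 108 * δ₀⁻¹ ^ 3 * ρ ^ 2 := by
  classical
  set S := Finset.univ.filter fun i : Fin N => ρ - k - 1 < dist (y i) c ∧ dist (y i) c ≤ ρ - k
    with hS
  -- empty shell if `ρ - k < 0`
  rcases lt_or_ge (ρ - k) 0 with hneg | hR₂
  · have : S = ∅ := by
      rw [Finset.eq_empty_iff_forall_notMem]
      intro i hi
      rw [hS, Finset.mem_filter] at hi
      linarith [hi.2.2, dist_nonneg (x := y i) (y := c)]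
    rw [this, Finset.card_empty, Nat.cast_zero]; positivity
  -- `y` is injective on `S` (separation), so count the image
  have hinj : Set.InjOn y S := by
    intro i _ j _ hij
    by_contra hne
    have := hsep i j hne
    rw [hij, dist_self] at this
    linarith
  have hcard : S.card = (S.image y).card := (Finset.card_image_of_injOn hinj).symm
  have hpack := card_le_of_separated_of_mem_shell (S.image y) c (r := δ₀) (R₁ := ρ - k - 1)
    (R₂ := ρ - k) hδ₀ hR₂ (by linarith) ?_ ?_
  rotate_left
  · intro p hp
    rw [Finset.mem_image] at hp
    obtain ⟨i, hi, rfl⟩ := hp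
    rw [hS, Finset.mem_filter] at hi
    exact ⟨hi.2.1.le, hi.2.2⟩
  · intro p hp q hq hpq
    rw [Finset.mem_image] at hp hq
    obtain ⟨i, -, rfl⟩ := hp
    obtain ⟨j, -, rfl⟩ := hq
    exact hsep i j fun h => hpq (by rw [h])
  have hfr : finrank ℝ (EuclideanSpace ℝ (Fin 3)) = 3 := by simp
  rw [hfr] at hpack
  rw [hcard]
  refine hpack.trans ?_
  -- `(2R₂/δ₀ + 1)³ − (max (2R₁/δ₀ − 1) 0)³ ≤ 3 x² g ≤ 108 δ₀⁻³ ρ²`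
  set x : ℝ := 2 * (ρ - k) / δ₀ + 1 with hx
  have hgoal : 2 * (ρ - ↑k - 1) / δ₀ - 1 = x - (2 / δ₀ + 2) := by rw [hx]; field_simp; ring
  rw [hgoal]
  have hxnn : 0 ≤ x := by rw [hx]; positivity
  have hgnn : (0 : ℝ) ≤ 2 / δ₀ + 2 := by positivity
  refine (cube_sub_cube_le hxnn hgnn).trans ?_
  have hk0 : (0 : ℝ) ≤ k := Nat.cast_nonneg k
  have hxle : x ≤ 3 * ρ / δ₀ := by
    rw [hx, div_add_one hδ₀.ne', div_le_div_iff_of_pos_right hδ₀]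
    nlinarith
  have hgle : 2 / δ₀ + 2 ≤ 4 / δ₀ := by
    rw [div_add' _ _ _ hδ₀.ne', div_le_div_iff_of_pos_right hδ₀]; linarith
  have hx2 : x ^ 2 ≤ (3 * ρ / δ₀) ^ 2 := pow_le_pow_left₀ hxnn hxle 2
  calc 3 * x ^ 2 * (2 / δ₀ + 2) ≤ 3 * (3 * ρ / δ₀) ^ 2 * (4 / δ₀) := by
        gcongr
    _ = 108 * δ₀⁻¹ ^ 3 * ρ ^ 2 := by field_simp; ring

/-! ## Cross sums across a sphere -/

/-- `∑_{k=1}^{K} k⁻³ ≤ 2` (indeed `≤ 2 − 1/K`). [folklore] -/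
theorem sum_Icc_inv_pow_three_le (K : ℕ) :
    ∑ k ∈ Finset.Icc 1 K, ((k : ℝ))⁻¹ ^ 3 ≤ 2 := by
  have key : ∀ n : ℕ, ∑ k ∈ Finset.Icc 1 (n + 1), ((k : ℝ))⁻¹ ^ 3 ≤ 2 - ((n + 1 : ℕ) : ℝ)⁻¹ := by
    intro n
    induction n with
    | zero => norm_num
    | succ n ih =>
      rw [Finset.sum_Icc_succ_top (by omega : 1 ≤ n + 1 + 1)]
      set a : ℝ := ((n + 1 : ℕ) : ℝ) with ha_def
      have ha : (1 : ℝ) ≤ a := by rw [ha_def]; exact_mod_cast Nat.succ_pos n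
      have hcast : ((n + 1 + 1 : ℕ) : ℝ) = a + 1 := by rw [ha_def]; push_cast; ring
      rw [hcast]
      have e1 : a⁻¹ - (a + 1)⁻¹ = (a * (a + 1))⁻¹ := by
        field_simp
        ring
      have e2 : (a + 1)⁻¹ ^ 3 ≤ (a * (a + 1))⁻¹ := by
        rw [inv_pow]
        exact inv_anti₀ (by positivity) (by nlinarith [sq_nonneg a])
      linarith
  rcases Nat.eq_zero_or_pos K with hK | hK
  · subst hK; simp
  · obtain ⟨n, rfl⟩ : ∃ n, K = n + 1 := ⟨K - 1, by omega⟩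
    exact (key n).trans (by linarith [inv_nonneg.2 (show (0 : ℝ) ≤ ((n + 1 : ℕ) : ℝ) by positivity)])

/-- **Cross sums across a sphere (area law).** Let `y` be a `δ₀`-separated configuration in `ℝ³`
(`0 < δ₀ ≤ 1`) whose far tails obey `∑_{j ≠ i, |yᵢ−yⱼ| ≥ ℓ} |yᵢ−yⱼ|⁻⁶ ≤ C_t ℓ⁻³` for all
`ℓ ≥ δ₀`. Then for every centre `c` and radius `ρ ≥ 1`,
`∑_{|yᵢ−c| ≤ ρ} ∑_{|yⱼ−c| > ρ} |yᵢ−yⱼ|⁻⁶ ≤ 108 δ₀⁻³ C_t (δ₀⁻³ + 2) ρ²`: a particle at depth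
`t = ρ − |yᵢ − c|` sees the outside only at distances `> t`, hence contributes `≤ C_t max(⌊t⌋, δ₀)⁻³`,
and the unit shells at integer depth `k` hold `≤ 108 δ₀⁻³ ρ²` particles (`card_shell_le`).
[folklore] -/
theorem sum_cross_inv_pow_six_le_of_tail {δ₀ C : ℝ} (hδ₀ : 0 < δ₀) (hδ₁ : δ₀ ≤ 1) (hC : 0 ≤ C)
    {N : ℕ} (y : Fin N → EuclideanSpace ℝ (Fin 3))
    (hsep : ∀ i j : Fin N, i ≠ j → δ₀ ≤ dist (y i) (y j))
    (htail : ∀ (i : Fin N) (ℓ : ℝ), δ₀ ≤ ℓ →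
      ∑ j ∈ (Finset.univ.erase i).filter (fun j => ℓ ≤ dist (y i) (y j)),
        (dist (y i) (y j))⁻¹ ^ 6 ≤ C * ℓ⁻¹ ^ 3)
    (c : EuclideanSpace ℝ (Fin 3)) {ρ : ℝ} (hρ : 1 ≤ ρ) :
    ∑ i ∈ Finset.univ.filter (fun i : Fin N => dist (y i) c ≤ ρ),
      ∑ j ∈ Finset.univ.filter (fun j : Fin N => ρ < dist (y j) c), (dist (y i) (y j))⁻¹ ^ 6 ≤
      108 * δ₀⁻¹ ^ 3 * C * (δ₀⁻¹ ^ 3 + 2) * ρ ^ 2 := by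
  classical
  set In := Finset.univ.filter (fun i : Fin N => dist (y i) c ≤ ρ) with hIn
  set Out := Finset.univ.filter (fun j : Fin N => ρ < dist (y j) c) with hOut
  -- depth index and the per-depth weight
  set kk : Fin N → ℕ := fun i => ⌊ρ - dist (y i) c⌋₊ with hkk
  set b : ℕ → ℝ := fun k => if k = 0 then δ₀⁻¹ ^ 3 else ((k : ℝ))⁻¹ ^ 3 with hb
  have hb_nonneg : ∀ k, 0 ≤ b k := by
    intro k; simp only [hb]; split_ifs <;> positivity
  -- (1) inner sums: `≤ C * b (kk i)`
  have hinner : ∀ i ∈ In, ∑ j ∈ Out, (dist (y i) (y j))⁻¹ ^ 6 ≤ C * b (kk i) := by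
    intro i hi
    rw [hIn, Finset.mem_filter] at hi
    have hti : 0 ≤ ρ - dist (y i) c := by linarith [hi.2]
    -- the range `ℓ`
    set ℓ : ℝ := if kk i = 0 then δ₀ else (kk i : ℝ) with hℓ
    have hℓδ : δ₀ ≤ ℓ := by
      simp only [hℓ]; split_ifs with h0
      · exact le_rfl
      · have : (1 : ℝ) ≤ kk i := by exact_mod_cast Nat.one_le_iff_ne_zero.2 h0
        linarith
    have hℓt : ℓ ≤ max (ρ - dist (y i) c) δ₀ := by
      simp only [hℓ]; split_ifs with h0
      · exact le_max_right _ _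
      · exact (Nat.floor_le hti).trans (le_max_left _ _)
    have hsub : Out ⊆ (Finset.univ.erase i).filter (fun j => ℓ ≤ dist (y i) (y j)) := by
      intro j hj
      rw [hOut, Finset.mem_filter] at hj
      have hne : j ≠ i := by rintro rfl; linarith [hi.2, hj.2]
      rw [Finset.mem_filter, Finset.mem_erase]
      refine ⟨⟨hne, Finset.mem_univ _⟩, hℓt.trans (max_le ?_ (hsep i j (Ne.symm hne)))⟩
      have := dist_triangle (y j) (y i) c
      rw [dist_comm (y j) (y i)] at this
      linarith [hj.2]
    calc ∑ j ∈ Out, (dist (y i) (y j))⁻¹ ^ 6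
        ≤ ∑ j ∈ (Finset.univ.erase i).filter (fun j => ℓ ≤ dist (y i) (y j)),
            (dist (y i) (y j))⁻¹ ^ 6 :=
          Finset.sum_le_sum_of_subset_of_nonneg hsub fun _ _ _ => by positivity
      _ ≤ C * ℓ⁻¹ ^ 3 := htail i ℓ hℓδ
      _ = C * b (kk i) := by
          simp only [hℓ, hb]; split_ifs <;> rfl
  -- (2) regroup by depth: fibres of `kk` over `range (⌊ρ⌋₊ + 1)` lie in unit shells
  have hmaps : ∀ i ∈ In, kk i ∈ Finset.range (⌊ρ⌋₊ + 1) := by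
    intro i hi
    rw [hIn, Finset.mem_filter] at hi
    rw [Finset.mem_range, Nat.lt_succ_iff]
    exact Nat.floor_le_floor (by linarith [dist_nonneg (x := y i) (y := c)])
  have hfiber : ∀ k ∈ Finset.range (⌊ρ⌋₊ + 1),
      ((In.filter fun i => kk i = k).card : ℝ) ≤ 108 * δ₀⁻¹ ^ 3 * ρ ^ 2 := by
    intro k _
    refine le_trans ?_ (card_shell_le hδ₀ hδ₁ y hsep c hρ k)
    exact_mod_cast Finset.card_le_card (fun i hi => by
      rw [Finset.mem_filter] at hi ⊢
      rw [hIn, Finset.mem_filter] at hi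
      obtain ⟨⟨-, hic⟩, hk⟩ := hi
      have hti : 0 ≤ ρ - dist (y i) c := by linarith
      have h1 := Nat.floor_le hti
      have h2 := Nat.lt_floor_add_one (ρ - dist (y i) c)
      simp only [hkk] at hk
      rw [hk] at h1 h2
      exact ⟨Finset.mem_univ _, by linarith, by linarith⟩)
  -- (3) the weights sum to at most `δ₀⁻³ + 2`
  have hbsum : ∑ k ∈ Finset.range (⌊ρ⌋₊ + 1), b k ≤ δ₀⁻¹ ^ 3 + 2 := by
    rw [Finset.range_eq_Ico, Finset.sum_eq_sum_Ico_succ_bot (Nat.succ_pos _)]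
    simp only [hb, if_true]
    gcongr
    have hIco : Finset.Ico 1 (⌊ρ⌋₊ + 1) = Finset.Icc 1 ⌊ρ⌋₊ := by
      ext k; simp
    rw [hIco]
    calc ∑ k ∈ Finset.Icc 1 ⌊ρ⌋₊, (if k = 0 then δ₀⁻¹ ^ 3 else ((k : ℝ))⁻¹ ^ 3)
        = ∑ k ∈ Finset.Icc 1 ⌊ρ⌋₊, ((k : ℝ))⁻¹ ^ 3 := by
          refine Finset.sum_congr rfl fun k hk => ?_
          rw [Finset.mem_Icc] at hk
          rw [if_neg (by omega)]
      _ ≤ 2 := sum_Icc_inv_pow_three_le _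
  -- assemble
  calc ∑ i ∈ In, ∑ j ∈ Out, (dist (y i) (y j))⁻¹ ^ 6
      ≤ ∑ i ∈ In, C * b (kk i) := Finset.sum_le_sum hinner
    _ = ∑ k ∈ Finset.range (⌊ρ⌋₊ + 1), ∑ i ∈ In.filter (fun i => kk i = k), C * b (kk i) :=
        (Finset.sum_fiberwise_of_maps_to hmaps _).symm
    _ = ∑ k ∈ Finset.range (⌊ρ⌋₊ + 1), ((In.filter fun i => kk i = k).card : ℝ) * (C * b k) := by
        refine Finset.sum_congr rfl fun k _ => ?_
        rw [Finset.sum_congr rfl fun i hi => by rw [(Finset.mem_filter.1 hi).2], Finset.sum_const,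
          nsmul_eq_mul]
    _ ≤ ∑ k ∈ Finset.range (⌊ρ⌋₊ + 1), (108 * δ₀⁻¹ ^ 3 * ρ ^ 2) * (C * b k) := by
        refine Finset.sum_le_sum fun k hk => ?_
        exact mul_le_mul_of_nonneg_right (hfiber k hk) (mul_nonneg hC (hb_nonneg k))
    _ = (108 * δ₀⁻¹ ^ 3 * ρ ^ 2 * C) * ∑ k ∈ Finset.range (⌊ρ⌋₊ + 1), b k := by
        rw [Finset.mul_sum]; refine Finset.sum_congr rfl fun k _ => by ring
    _ ≤ (108 * δ₀⁻¹ ^ 3 * ρ ^ 2 * C) * (δ₀⁻¹ ^ 3 + 2) :=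
        mul_le_mul_of_nonneg_left hbsum (by positivity)
    _ = 108 * δ₀⁻¹ ^ 3 * C * (δ₀⁻¹ ^ 3 + 2) * ρ ^ 2 := by ring

end Literature.MathematicalPhysics.StatisticalMechanics

end
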